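import Mathlib
import Summits.MatrixMultiplication.Statement
import Summits.MatrixMultiplication.MatrixMultiplication.Theorems.GraphEquationsForwardADBlocks
import Literature.Computability.AlgebraicComplexity.ConstantFreeCircuits

/-!
# Graph equations: `ForwardModeAD` proved — the differentiated equation system

Route `GraphEquations`, crux `MultiplicityReduction` (line `purisplit`, stub BOP′ at `K = 2`).
`GraphEquationsDeflation` isolated the ROUTINE bookkeeping hypothesis

  `ForwardModeAD : ∀ n E E_μ μ, E fan-in two → E_μ fan-in two → (E_μ computes every ι(μ_q) as a
    test) → ∃ E', fan-in two ∧ E.DeflatesTo μ E' ∧ tests(E') ⊆ tests(E) ∪ D_μ tests(E) ∧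
    cost E' ≤ 4·cost E + cost E_μ`

(forward-mode differentiation of a straight-line program; Wengert 1964, Baur–Strassen 1983,
BCS97 §7.1).  With the blocks of `GraphEquationsForwardADBlocks` this file PROVES it
(`forwardModeAD`): `adSystem E E_μ jμ` = the well-formed program of `E` (`trimJunk`, same values
and size), then the program of `E_μ` with shifted references, then three gates per gate of `E`;
tests = the tests of `E` and their derivatives (junk test indices of `E` go to the junk index
`4·cost E + cost E_μ`); `adSystem_cost / _isFanInTwo / _testPoly_of_lt / _testPoly_deriv /
_deflatesTo / _tests_shape` are its properties.

Consequence: `boundedOrderPurification_two_of_uniform'` — BOP′ at `K = 2` follows from the single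
open residual `UniformKernelFieldDeflation β β'` in the range `2 ≤ β < β' < 5/2` ALONE (above
`5/2` the conclusion is the landed rung `eqAdmissiblePure_five_halves_via_rung`).  No sorry.
-/

-- dupNamespace: forced by the nested Summit.MatrixMultiplication.MatrixMultiplication layout (D-0017)
set_option linter.dupNamespace false

noncomputable section

open scoped BigOperators

namespace Summit.MatrixMultiplication.MatrixMultiplication.Theorems.GraphEquations

open MvPolynomial Literature.Computability.AlgebraicComplexity
open Literature.Computability.AlgebraicComplexity.ArithCircuit

variable {n : ℕ}

/-- Shifting does not change the fan-in (the `Literature` version `fanIn_shift_aux` of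
`ArithCircuitProofs` is private). -/
@[simp] theorem Gate.fanIn_shift {k : Type*} {σ : Type*} (m : ℕ) (g : Gate k σ) :
    (g.shift m).fanIn = g.fanIn := by
  cases g <;> simp [Gate.shift, Gate.fanIn, Gate.args]

/-! ## The differentiated system and `ForwardModeAD` -/

/-- The operand reading `ι(μ_q)` = test `jμ q` of `E_μ` off the appended program of `E_μ` (a junk
test index, whose test polynomial is `0`, is read as `const 0`). -/
def muOp (L Lμ : ℕ) (jμ : Fin n × Fin n → ℕ) (q : Fin n × Fin n) : Operand ℂ (GraphVars n) :=
  if jμ q < Lμ then .gate (L + jμ q) else .const 0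

/-- **THE DIFFERENTIATED SYSTEM** `E' = AD(E, E_μ)`: the well-formed program of `E`, then the
program of `E_μ` (shifted), then three gates per gate of `E`; tests = the tests of `E` and their
derivatives (junk test indices of `E` are sent to the junk index `4·cost E + cost E_μ`). -/
def adSystem (E Eμ : EqSystem n) (jμ : Fin n × Fin n → ℕ) : EqSystem n where
  circuit :=
    { gates := E.circuit.trimJunk.gates ++ Eμ.circuit.gates.map (Gate.shift E.cost) ++
          dBlocks (E.cost + Eμ.cost) (muOp E.cost Eμ.cost jμ) E.circuit.trimJunk.gates E.cost
      output := .const 0 }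
  tests := E.tests.map (fun j => if j < E.cost then j else 4 * E.cost + Eμ.cost) ++
    E.tests.map (fun j => if j < E.cost then E.cost + Eμ.cost + 3 * j + 2 else 4 * E.cost + Eμ.cost)

section ADSystem

variable (E Eμ : EqSystem n) (jμ : Fin n × Fin n → ℕ) (μ : Fin n × Fin n → MvPolynomial (MatMulVars n) ℂ)

/-- `trimJunk` keeps the number of gates (`= cost E`). -/
theorem trimJunk_gates_length : E.circuit.trimJunk.gates.length = E.cost := by
  simpa [ArithCircuit.size, EqSystem.cost] using size_trimJunk E.circuit

/-- `cost E' = 4·cost E + cost E_μ`. -/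
theorem adSystem_cost : (adSystem E Eμ jμ).cost = 4 * E.cost + Eμ.cost := by
  simp only [EqSystem.cost, ArithCircuit.size, adSystem, List.length_append, List.length_map,
    dBlocks_length]
  rw [← ArithCircuit.size, size_trimJunk]
  simp only [ArithCircuit.size]
  ring

/-- `E'` has fan-in two. -/
theorem adSystem_isFanInTwo (hE : E.circuit.IsFanInTwo) (hEμ : Eμ.circuit.IsFanInTwo) :
    (adSystem E Eμ jμ).circuit.IsFanInTwo := by
  intro g hg
  simp only [adSystem, List.mem_append, List.mem_map] at hg
  rcases hg with (hg | ⟨g₀, hg₀, rfl⟩) | hg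
  · exact hE.trimJunk g hg
  · rw [Gate.fanIn_shift]; exact hEμ g₀ hg₀
  · exact fanIn_of_mem_dBlocks _ _ (fun g hg => hE.trimJunk g hg) hg

/-- The tests of `E` survive: `t'_j = t_j` for `j < cost E`. -/
theorem adSystem_testPoly_of_lt {j : ℕ} (hj : j < E.cost) :
    (adSystem E Eμ jμ).testPoly j = E.testPoly j := by
  simp only [EqSystem.testPoly, adSystem, List.append_assoc]
  rw [EqSystem.getD_gateValues_append (by rw [trimJunk_gates_length]; exact hj), gateValues_trimJunk]

/-- The derivative of test `j < cost E` sits at `cost E + cost E_μ + 3j + 2`. -/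
theorem adSystem_testPoly_deriv (hE : E.circuit.IsFanInTwo)
    (hjμ : ∀ q, Eμ.testPoly (jμ q) = liftAB n (μ q)) {j : ℕ} (hj : j < E.cost) :
    (adSystem E Eμ jμ).testPoly (E.cost + Eμ.cost + 3 * j + 2) = derivC μ (E.testPoly j) := by
  have hL := trimJunk_gates_length E
  simp only [EqSystem.testPoly, adSystem]
  rw [getD_dBlocks μ (wellFormed_trimJunk E.circuit).1 (fun g hg => hE.trimJunk g hg) ⟨_, rfl⟩
    (by simp [hL, EqSystem.cost, ArithCircuit.size]) ?_ (by rw [hL]) hj, gateValues_trimJunk]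
  intro q ws
  have happ : gateValues (E.circuit.trimJunk.gates ++ Eμ.circuit.gates.map (Gate.shift E.cost)) =
      gateValues E.circuit.gates ++ gateValues Eμ.circuit.gates := by
    rw [← hL, gateValues_append_shift, gateValues_trimJunk]
  rw [happ]
  unfold muOp
  split_ifs with h
  · rw [Operand.eval_gate, List.append_assoc, List.getD_eq_getElem?_getD,
      List.getElem?_append_right (by simp [EqSystem.cost, ArithCircuit.size]),
      List.getElem?_append_left (by simpa [EqSystem.cost, ArithCircuit.size] using h)]
    simpa [EqSystem.testPoly, EqSystem.cost, ArithCircuit.size, List.getD_eq_getElem?_getD] using hjμ q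
  · have h0 : Eμ.testPoly (jμ q) = 0 := EqSystem.testPoly_eq_zero_of_le (not_lt.mp h)
    rw [← hjμ q, h0]; exact C_0

/-- The junk index of `E'`. -/
theorem adSystem_testPoly_junk : (adSystem E Eμ jμ).testPoly (4 * E.cost + Eμ.cost) = 0 :=
  EqSystem.testPoly_eq_zero_of_le (adSystem_cost E Eμ jμ).le

/-- `E'` contains the `μ`-deflation of `E`. -/
theorem adSystem_deflatesTo (hE : E.circuit.IsFanInTwo) (hjμ : ∀ q, Eμ.testPoly (jμ q) = liftAB n (μ q)) :
    E.DeflatesTo μ (adSystem E Eμ jμ) := by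
  refine ⟨fun j hj => ⟨_, List.mem_append_left _ (List.mem_map.mpr ⟨j, hj, rfl⟩), ?_⟩,
    fun j hj => ⟨_, List.mem_append_right _ (List.mem_map.mpr ⟨j, hj, rfl⟩), ?_⟩⟩
  · split_ifs with h
    · exact adSystem_testPoly_of_lt E Eμ jμ h
    · rw [adSystem_testPoly_junk, EqSystem.testPoly_eq_zero_of_le (not_lt.mp h)]
  · split_ifs with h
    · exact adSystem_testPoly_deriv E Eμ jμ μ hE hjμ h
    · rw [adSystem_testPoly_junk, EqSystem.testPoly_eq_zero_of_le (not_lt.mp h), derivC_zero]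

/-- Every test of `E'` is a test of `E` or the derivative of one. -/
theorem adSystem_tests_shape (hE : E.circuit.IsFanInTwo) (hjμ : ∀ q, Eμ.testPoly (jμ q) = liftAB n (μ q)) :
    ∀ j' ∈ (adSystem E Eμ jμ).tests,
      (∃ j ∈ E.tests, (adSystem E Eμ jμ).testPoly j' = E.testPoly j) ∨
        (∃ j ∈ E.tests, (adSystem E Eμ jμ).testPoly j' = derivC μ (E.testPoly j)) := by
  intro j' hj'
  simp only [adSystem, List.mem_append, List.mem_map] at hj'
  rcases hj' with ⟨j, hj, rfl⟩ | ⟨j, hj, rfl⟩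
  · refine Or.inl ⟨j, hj, ?_⟩
    split_ifs with h
    · exact adSystem_testPoly_of_lt E Eμ jμ h
    · rw [adSystem_testPoly_junk, EqSystem.testPoly_eq_zero_of_le (not_lt.mp h)]
  · refine Or.inr ⟨j, hj, ?_⟩
    split_ifs with h
    · exact adSystem_testPoly_deriv E Eμ jμ μ hE hjμ h
    · rw [adSystem_testPoly_junk, EqSystem.testPoly_eq_zero_of_le (not_lt.mp h), derivC_zero]

end ADSystem

/-- **`ForwardModeAD` HOLDS** (Wengert 1964 / BCS97 §7.1 on the tree model `ArithCircuit`). -/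
theorem forwardModeAD : ForwardModeAD := by
  intro n E Eμ μ hE hEμ hμ
  choose jμ _ hjμ using hμ
  exact ⟨adSystem E Eμ jμ, adSystem_isFanInTwo E Eμ jμ hE hEμ, adSystem_deflatesTo E Eμ jμ μ hE hjμ,
    adSystem_tests_shape E Eμ jμ μ hE hjμ, (adSystem_cost E Eμ jμ).le⟩

/-! ## Consequences for rung `K = 2` of BOP′ -/

/-- Rung `2` ⇒ kernel-field deflation at every larger exponent, from the uniform residual ALONE. -/
theorem kernelFieldDeflation_of_uniform' {β β' : ℝ} (hββ' : β ≤ β')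
    (hU : UniformKernelFieldDeflation β β') (h : EqAdmissibleIdealIso β 2) : KernelFieldDeflation β' :=
  kernelFieldDeflation_of_uniform hββ' hU forwardModeAD h

/-- **BOP′ AT `K = 2` FROM THE UNIFORM RESIDUAL ALONE, in the only range that matters**
(`2 ≤ β < β' < 5/2`; for `β' ≥ 5/2` the conclusion is the landed rung
`eqAdmissiblePure_five_halves_via_rung`). -/
theorem boundedOrderPurification_two_of_uniform'
    (hU : ∀ β β' : ℝ, 2 ≤ β → β < β' → β' < 5 / 2 → UniformKernelFieldDeflation β β')
    (β : ℝ) (hβ : 2 ≤ β) (hiso : EqAdmissibleIdealIso β 2) (β' : ℝ) (hββ' : β < β') :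
    EqAdmissiblePure β' := by
  by_cases h : β' < 5 / 2
  · exact eqAdmissiblePure_of_idealIso_one
      (kernelFieldDeflation_of_uniform hββ'.le (hU β β' hβ hββ' h) forwardModeAD hiso).eqAdmissibleIdealIso_one
  · exact eqAdmissiblePure_five_halves_via_rung.mono (not_lt.mp h)


/-! ## Witness: tests in `I²` (the squared systems of `GraphEquationsSquaredSystems`) are deflated
by a CONSTANT field at cost `4·cost E + n²` -/

/-- A derivation maps `J²` into `J` (Leibniz). -/
theorem derivC_mem_of_mem_sq (μ : Fin n × Fin n → MvPolynomial (MatMulVars n) ℂ)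
    {J : Ideal (MvPolynomial (GraphVars n) ℂ)} {t : MvPolynomial (GraphVars n) ℂ} (ht : t ∈ J ^ 2) :
    derivC μ t ∈ J := by
  rw [pow_two] at ht
  refine Submodule.mul_induction_on ht (fun a ha b hb => ?_) (fun x y hx hy => ?_)
  · rw [derivC_mul]; exact J.add_mem (J.mul_mem_left _ hb) (J.mul_mem_right _ ha)
  · rw [derivC_add]; exact J.add_mem hx hy

/-- The program with one gate `γ_q • 1` per position `q` (constants of fan-in one), all gates tested. -/
def constSystem (γ : Fin n × Fin n → ℂ) : EqSystem n where
  circuit :=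
    { gates := List.ofFn fun i : Fin (Fintype.card (Fin n × Fin n)) =>
        Gate.sum [(γ ((Fintype.equivFin (Fin n × Fin n)).symm i), .const 1)]
      output := .const 0 }
  tests := List.range (Fintype.card (Fin n × Fin n))

/-- `cost (constSystem γ) = n²`. -/
theorem constSystem_cost (γ : Fin n × Fin n → ℂ) : (constSystem γ).cost = n * n := by
  simp [constSystem, EqSystem.cost, ArithCircuit.size, Fintype.card_prod, Fintype.card_fin]

/-- `constSystem γ` has fan-in one. -/
theorem constSystem_isFanInTwo (γ : Fin n × Fin n → ℂ) : (constSystem γ).circuit.IsFanInTwo := by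
  intro g hg
  simp only [constSystem, List.mem_ofFn] at hg
  obtain ⟨i, rfl⟩ := hg
  simp [Gate.fanIn, Gate.args]

/-- Test number `e(q)` of `constSystem γ` is the constant `γ_q = ι(γ_q)`. -/
theorem constSystem_testPoly (γ : Fin n × Fin n → ℂ) (q : Fin n × Fin n) :
    (constSystem γ).testPoly (Fintype.equivFin (Fin n × Fin n) q) = liftAB n (C (γ q)) := by
  have hlt : ((Fintype.equivFin (Fin n × Fin n)) q : ℕ) < (constSystem γ).circuit.gates.length := by
    simpa [constSystem] using ((Fintype.equivFin (Fin n × Fin n)) q).isLt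
  simp only [EqSystem.testPoly]
  rw [getD_gateValues_eq_eval_take _ hlt]
  simp only [constSystem, List.getElem_ofFn, Fin.eta, Equiv.symm_apply_apply, Gate.eval, List.map_cons,
    List.map_nil, List.sum_cons, List.sum_nil, add_zero, Operand.eval, liftAB_C, smul_eq_C_mul, C_1, mul_one]

/-- **CONSTANT-FIELD DEFLATION.**  If the test ideal of `E` is initially isolated to order `2` over
`y` and the tests lie in `I²`, then for the deflation direction `γ` the CONSTANT field `μ = γ` is a
kernel field (every field is: `D_μ I² ⊆ I`), is computed by `constSystem γ` at cost `n²`, and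
deflates `E` to order `1` over the same `y`. -/
theorem exists_constField_deflation {E : EqSystem n} {y : MatMulVars n → ℂ}
    (hiso : E.IdealInitIsolatedAt 2 y) (hsq : ∀ j ∈ E.tests, E.testPoly j ∈ graphIdeal n ^ 2) :
    ∃ γ : Fin n × Fin n → ℂ,
      (∀ q, ∃ j ∈ (constSystem γ).tests, (constSystem γ).testPoly j = liftAB n (C (γ q))) ∧
      (∀ j ∈ E.tests, derivC (fun q => C (γ q)) (E.testPoly j) ∈ graphIdeal n) ∧
      (∀ E'' : EqSystem n, E.DeflatesTo (fun q => C (γ q)) E'' → E''.IdealInitIsolatedAt 1 y) := by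
  obtain ⟨γ, hγ⟩ := hiso.deflate
  refine ⟨γ, fun q => ⟨_, ?_, constSystem_testPoly γ q⟩, fun j hj => derivC_mem_of_mem_sq _ (hsq j hj),
    fun E'' hD => hγ _ (fun q => eval_C _) E'' hD⟩
  simp only [constSystem, List.mem_range]
  exact ((Fintype.equivFin (Fin n × Fin n)) q).isLt

/-- **WITNESS.**  A CORRECT system with tests in `I²` (e.g. the squared systems
`squareTests E₀ 1` of `GraphEquationsSquaredSystems`, which refuted purification INSIDE the test
ideal) whose test ideal is initially isolated to order `2` over `y` has a CORRECT deflation that is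
REDUCED at the graph point over `y`, of cost `≤ 4·cost E + n²`: the kernel-field mechanism at
linear cost on that class. -/
theorem exists_reduced_deflation_of_sq_tests {E : EqSystem n} {y : MatMulVars n → ℂ} (hE : E.Correct)
    (hiso : E.IdealInitIsolatedAt 2 y) (hsq : ∀ j ∈ E.tests, E.testPoly j ∈ graphIdeal n ^ 2) :
    ∃ E' : EqSystem n, E'.Correct ∧ E'.ReducedAt (graphPoint y) ∧ E'.cost ≤ 4 * E.cost + n * n := by
  obtain ⟨γ, hμ, hKF, hdefl⟩ := exists_constField_deflation hiso hsq
  obtain ⟨E', hfan, hD, hshape, hcost⟩ :=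
    forwardModeAD n E (constSystem γ) (fun q => C (γ q)) hE.1 (constSystem_isFanInTwo γ) hμ
  have hE' : E'.Correct := hE.of_deflatesTo hfan hD hshape hKF
  exact ⟨E', hE', EqSystem.reducedAt_of_idealInitIsolatedAt_one hE' (hdefl E' hD),
    (constSystem_cost γ) ▸ hcost⟩

end Summit.MatrixMultiplication.MatrixMultiplication.Theorems.GraphEquations
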